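import Summits.BirchSwinnertonDyer.Rank1Residual.X11b.AnticyclotomicControlLocallyTrivial
import Summits.BirchSwinnertonDyer.Rank1Residual.X11b.AnticyclotomicControlFromAtoms
import HarnessLib

/-!
# X11b, route R1 — CLASS LEVEL on the locally-trivial sub-population: `LocallyTrivialAt W p`
# (`E(ℚ_ℓ)[p] = 0` and `p ∤ c_ℓ(E)` at every bad `ℓ ≠ p`) ⟹ (CTL) `R1ControlOnTreeAt` is the TWO
# Poitou–Tate atoms (P6) ∧ (L10)

HONEST FRAMING (cell `b2b-bsdres`, run/shared/lean/b2b/bsd-rank1-residual/, verbatim in every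
file): the goal of the cell is to DELETE the COMBINATION-SHAPED residual classes of the
Birch–Swinnerton-Dyer formula for ALL analytic-rank `≤ 1` elliptic curves over `ℚ` — "full BSD
formula for every rank `≤ 1` curve in class `C`" assembled STRICTLY from published theorems — so
that the rank-`≤ 1` remainder becomes exactly the CONSTRUCTION-SHAPED classes, which are TYPED
(missing-input `Prop`s), NOT attempted. This is not "finishing BSD". Sub-cell
`b2b-bsdres-multr1-p1` (X11b, route R1 = Castella 2018 Thm. A re-proved along the author's
erratum); a RESEARCH ROUTE; no claim beyond the stated class; X11b stays CONSTRUCTION-SHAPED;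
nothing here changes a label; no named fact is minted (two `Prop`-valued predicates with bodies —
a decidable per-pair side condition and a typed shape, nothing asserted — and theorems; no `sorry`).

## What this file does

* `LocallyTrivialAt W p` — the decidable per-pair condition "at every prime `ℓ ∣ N_E`, `ℓ ≠ p`:
  `E(ℚ_ℓ)` has no point of order `p` and `p ∤ c_ℓ(E)`" (equivalently `p ∤ c_ℓ(E)·#Ẽ_ns(𝔽_ℓ)`,
  `#Ẽ_ns(𝔽_ℓ) = ℓ − a_ℓ`; census: the unit's REPORT §22, job of gen 12). NOT a new class and NOT a
  label: a side condition under which two of the four typed atoms of (CTL) become theorems.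
* `R1TwoAtomsAt W p` — (P6) `BaseSelmerCountAt` ∧ (L10) `CoinvariantsTrivialAt` at every datum of
  `R1ControlOnTreeAt` (PUB shapes, Poitou–Tate; nothing asserted).
* glue: at a place `w ∈ Σ(N⁺)` above `ℓ` (degree one), `E(ℚ_ℓ)[p] = 0 ⟹ E(K_w)[p] = 0`
  (`AnticyclotomicLocalKernelTrivial`) and `c_w(E/K) = c_ℓ(E)`
  (`localTamagawaNumber_baseChange_eq_of_degree_one`); so `LocallyTrivialAt W p` puts every
  `w ∈ Σ(N⁺)` of every erratum field in the locally-trivial case (`locallyTrivial_nPlusPlaces`).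
* **`r1ControlOnTreeAt_of_two_atoms` : `LocallyTrivialAt W p → R1TwoAtomsAt W p →
  R1ControlOnTreeAt W p`** — on this sub-population Cas18 Thm. 2.3 at every datum of route R1 IS
  JSW17 Prop. 3.2.1/(7.1.5) (the count `#Sel_𝔭(K, E[p^∞]) = #Ш·p^{2(ord log − 1 − ord idx)}·∏_{w∣p} c_w`)
  together with Lemma 3.3.3 (`Sel_Γ = 0`); the control map is an isomorphism `Sel_𝔭(K, E[p^∞]) ≅
  Sel_𝔭(K_∞, E[p^∞])^Γ` with no local defect and `ord_p ∏_{w∣N⁺} c_w = Σ_{w∣p} ord_p c_w`.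
  (The statement of record `R1.bsdp_of_onTree` consumes `R1ControlOnTreeAt` at every pair; on this
  sub-population it is thus fed by two atoms, elsewhere by four, `r1ControlOnTreeAt_of_atoms`.)

References: [JetchevSkinnerWan2017] Prop. 3.2.1, Lemma 3.3.3, Prop. 3.3.4 (arXiv:1512.06894 pp. 10–13);
[Castella2018] Thm. 2.3, §5 (arXiv:1704.06608 pp. 5, 12); [GreenbergLNM1716] §3 pp. 74–75.
-/

noncomputable section

open scoped Classical

open WeierstrassCurve NumberField IsDedekindDomain Field
open Literature.NumberTheory.EllipticCurves Literature.NumberTheory.EllipticCurves.GreenbergSelmer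
open Literature.NumberTheory.EllipticCurves.ModularForms
open Literature.NumberTheory.EllipticCurves.Rank1Residual
open Literature.NumberTheory.EllipticCurves.Rank1Residual.Typed
open Literature.NumberTheory.GaloisRepresentations
open Summit.BirchSwinnertonDyer.Rank1Residual.X11b.AcSelmer

namespace Summit.BirchSwinnertonDyer.Rank1Residual.X11b

/-! ## The side condition and the two-atom shape -/

section Defs

/-- **`LocallyTrivialAt W p`** — at every prime `ℓ ∣ N_E` with `ℓ ≠ p`: `E(ℚ_ℓ)` has no point of order
`p`, and `p ∤ c_ℓ(E)` (the local Tamagawa number at the place of `ℚ` at `ℓ`). Decidable per pair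
(`⟸ p ∤ c_ℓ(E)·(ℓ − a_ℓ)`); under it every local kernel `ker r_w`, `w ∈ Σ(N⁺)`, of the anticyclotomic
control argument vanishes (Greenberg, p. 75). A side condition; nothing asserted; not a class label.
[cite: GreenbergLNM1716, §3 pp. 74–75 (the case `E(K_v)[p] = 0`)] -/
def LocallyTrivialAt (W : WeierstrassCurve ℚ) [W.IsElliptic] [W.IsGloballyMinimal] (p : ℕ)
    [Fact p.Prime] : Prop :=
  ∀ (ℓ : ℕ) [Fact ℓ.Prime], ℓ ∣ W.conductorNorm ℤ → ℓ ≠ p →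
    (∀ P : (W.baseChange ℚ_[ℓ]).toAffine.Point, p • P = 0 → P = 0) ∧
      ¬ p ∣ (W.baseChange ((ratPlace ℓ).adicCompletion ℚ)).localTamagawaNumber
        ((ratPlace ℓ).adicCompletionIntegers ℚ)

/-- **The two Poitou–Tate atoms of route R1 at every datum — PUB shapes** (JSW17 Prop. 3.2.1 with
(7.1.5), Lemma 3.3.3, on the constructed objects), same quantifier prefix as `R1ControlOnTreeAt` /
`R1PoitouTateAtomsAt` without the surjectivity atom (P9): (P6) `BaseSelmerCountAt p 𝔭 (embAt K p 𝔭) P`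
and (L10) `CoinvariantsTrivialAt`. A predicate on `(W, p)`; nothing asserted; NOT a named fact.
[cite: JetchevSkinnerWan2017, Prop. 3.2.1 and Lemma 3.3.3 (arXiv:1512.06894 pp. 10–12) (shape only; nothing asserted)]
[cite: Castella2018, Thm. 2.3 (arXiv:1704.06608 p. 5) (shape only; nothing asserted)] -/
def R1TwoAtomsAt (W : WeierstrassCurve ℚ) [W.IsElliptic] [W.IsGloballyMinimal] (p : ℕ)
    [Fact p.Prime] : Prop :=
  ∀ [NeZero (W.conductorNorm ℤ)] (q : ℕ) [Fact q.Prime] (K : Type) [Field K] [NumberField K]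
    (Dt : ModularParametrizationData W (W.conductorNorm ℤ))
    (H : HeegnerDatum (W.conductorNorm ℤ) (NumberField.discr K)) (ι : K →+* ℂ)
    (P : (W.baseChange K).toAffine.Point),
    ErratumHypotheses W p → W.analyticRank = 1 → q ≠ p → Mult W q →
    ¬ W.HasSplitMultiplicativeReductionAtPrime q → ¬ p ∣ padicValInt q W.minimalDiscriminantInt →
    IsErratumField W K q → Cas20Standing K p (W.conductorNorm ℤ / p) →
    WeierstrassCurve.Affine.Point.map ι.toRatAlgHom P = heegnerPointComplex Dt H →
    ¬ (p : ℤ) ∣ Dt.c → ¬ IsOfFinAddOrder P →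
    ∀ (κ : ZpExtension K p), κ.IsAnticyclotomic →
      ∀ (γ : Field.absoluteGaloisGroup K) [Fact (κ.IsTopGenerator γ)] (𝔭 : HeightOneSpectrum (𝓞 K))
        (h𝔭 : ((p : ℕ) : 𝓞 K) ∈ 𝔭.asIdeal) (he : 𝔭.asIdeal.ramificationIdx (𝓞 ℚ) = 1)
        (hf : 𝔭.asIdeal.inertiaDeg (𝓞 ℚ) = 1),
        BaseSelmerCountAt p 𝔭 (embAt K p 𝔭 h𝔭 he hf) P ∧ CoinvariantsTrivialAt (W.baseChange K) p κ 𝔭 γ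

end Defs

/-! ## Glue: the side condition at the places of `Σ(N⁺)` -/

section Glue

variable {W : WeierstrassCurve ℚ} [W.IsElliptic] [W.IsGloballyMinimal] {K : Type} [Field K]
  [NumberField K] {p : ℕ} [Fact p.Prime]

omit [W.IsElliptic] [W.IsGloballyMinimal] [Fact p.Prime] in
/-- The local Tamagawa number of `E` at the place `v ∩ ℚ` below `v`, rewritten at a place equal to it
(transport along an equality of places). [folklore] -/
theorem localTamagawaNumber_congr_place {u u' : HeightOneSpectrum (𝓞 ℚ)} (h : u = u') :
    (W.baseChange (u.adicCompletion ℚ)).localTamagawaNumber (u.adicCompletionIntegers ℚ) =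
      (W.baseChange (u'.adicCompletion ℚ)).localTamagawaNumber (u'.adicCompletionIntegers ℚ) := by
  subst h
  rfl

/-- **`LocallyTrivialAt W p` puts every `w ∈ Σ(N⁺)` in the locally-trivial case**: for `[K:ℚ] = 2`
and `w ∈ Σ(N⁺)` (above a prime `ℓ ∣ N_E`, `ℓ ≠ p`, `e = f = 1`): `E(K_w)[p] = 0` (transport of
`E(ℚ_ℓ)[p] = 0` along `K_w → ℚ_ℓ`) and `p ∤ c_w(E/K) = c_ℓ(E)`
(`localTamagawaNumber_baseChange_eq_of_degree_one`). [cite: GreenbergLNM1716, §3 pp. 74–75] [cite: Castella2018, §5 (arXiv:1704.06608 p. 12), "`c_w = c_ℓ` at split `ℓ`"] -/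
theorem locallyTrivial_nPlusPlaces (hLT : LocallyTrivialAt W p) {v : HeightOneSpectrum (𝓞 K)}
    (hv : v ∈ nPlusPlaces W K p) :
    (∀ R : ((W.baseChange K).baseChange (v.adicCompletion K)).toAffine.Point, p • R = 0 → R = 0) ∧
      ¬ p ∣ ((W.baseChange K).baseChange (v.adicCompletion K)).localTamagawaNumber
        (v.adicCompletionIntegers K) := by
  obtain ⟨hpv, hN, he, hf⟩ := (mem_nPlusPlaces_iff v).mp hv
  set ℓ : ℕ := (Rat.HeightOneSpectrum.primesEquiv (v.under (𝓞 ℚ)) : ℕ) with hℓdef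
  haveI hℓ : Fact ℓ.Prime := ⟨(Rat.HeightOneSpectrum.primesEquiv (v.under (𝓞 ℚ))).2⟩
  have hℓv : ((ℓ : ℕ) : 𝓞 K) ∈ v.asIdeal := natCast_primesEquiv_under_mem v
  have hℓp : ℓ ≠ p := fun h ↦ hpv (h ▸ hℓv)
  obtain ⟨h1, h2⟩ := hLT ℓ hN hℓp
  obtain ⟨e⟩ := exists_ringHom_adicCompletion_padic_of_degreeOne (p := ℓ) v hℓv he hf
  refine ⟨noPTorsion_baseChange_adicCompletion_of_ringHom W p v e h1, ?_⟩
  rw [localTamagawaNumber_baseChange_eq_of_degree_one W v he hf,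
    localTamagawaNumber_congr_place (under_eq_ratPlace_of_mem hℓv)]
  exact h2

end Glue

/-! ## Class level -/

section ClassLevel

variable (W : WeierstrassCurve ℚ) [W.IsElliptic] [W.IsGloballyMinimal] (p : ℕ) [Fact p.Prime]

/-- **(CTL) at class level from TWO atoms on the locally-trivial sub-population**:
`LocallyTrivialAt W p → R1TwoAtomsAt W p → R1ControlOnTreeAt W p` — Cas18 Thm. 2.3 at every datum
of route R1 is JSW17 Prop. 3.2.1/(7.1.5) ∧ Lemma 3.3.3 (Poitou–Tate), every other step being a kernel
theorem on the constructed objects (`controlOnTreeAt_of_two_atoms_of_noPTorsion`).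
[cite: Castella2018, Thm. 2.3 (arXiv:1704.06608 p. 5)] [cite: JetchevSkinnerWan2017, Thm. 3.3.1, Prop. 3.2.1, Lemma 3.3.3 (arXiv:1512.06894 pp. 10–12)] -/
theorem r1ControlOnTreeAt_of_two_atoms (hLT : LocallyTrivialAt W p) (hTA : R1TwoAtomsAt W p) :
    R1ControlOnTreeAt W p := by
  intro _ q _ K _ _ Dt H ι P hE hr hqp hmq hns hvq hK hCas hP hc hinf κ hκ γ _ 𝔭 h𝔭 he hf
  have hpN : p ∣ W.conductorNorm ℤ := dvd_conductorNorm_of_mult hE.2.1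
  have hsplit : SplitsIn K p := hK.2.2.1 p (Fact.out : p.Prime) hpN (Ne.symm hqp)
  obtain ⟨h6, h10⟩ := hTA q K Dt H ι P hE hr hqp hmq hns hvq hK hCas hP hc hinf κ hκ γ 𝔭 h𝔭 he hf
  exact controlOnTreeAt_of_two_atoms_of_noPTorsion hE hK.1 hsplit hκ γ 𝔭 h𝔭 he hf
    (embAt K p 𝔭 h𝔭 he hf) P h6 h10 fun v hv ↦ locallyTrivial_nPlusPlaces (K := K) hLT hv

end ClassLevel

end Summit.BirchSwinnertonDyer.Rank1Residual.X11b

end
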